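import Mathlib.Analysis.Complex.ExponentialBounds
import Mathlib.GroupTheory.SpecificGroups.Alternating
import Literature.Barriers.MatrixMultiplication.PackingBoundSequences
import Literature.Barriers.MatrixMultiplication.QuasirandomBarrierDirectProduct
import Literature.Barriers.MatrixMultiplication.QuasirandomBarrierLieTypeProofs
import Literature.Barriers.MatrixMultiplication.NilpotentGroupBarrierProofs
import Literature.RepresentationTheory.FiniteGroups.PermutationCharacter
import HarnessLib

/-!
# BCGPU 2023, §5: powers `SL(n,q)^m` with one parameter fixed are excluded; the alternating groups escape Cor. 3.3 — proved

Topic `Literature/Barriers/MatrixMultiplication` (D-0021 barrier catalogue for the summit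
`MatrixMultiplication`); proof file attached to the catalogue entry `QuasirandomBarrier.lean`
(Blasiak–Cohn–Grochow–Pratt–Umans 2023), making KERNEL STATEMENTS of the three premises which §5
("Open problems", p. 12 of the held text `paper:arxiv-2204.03826`) prints before posing its open
questions — so far they were only quoted, as prose, in `QuasirandomBarrier`'s `evasions_known:` and in
the module docstring of `QuasirandomBarrierLieType.lean` ("WHAT THIS IS NOT: … direct powers
`SL(n,q)^m` with `m → ∞` (the authors' open question, §5), or alternating groups").

Source, verbatim (J. Blasiak, H. Cohn, J. A. Grochow, K. Pratt, C. Umans, *Matrix multiplication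
via matrix groups*, ITCS 2023, arXiv:2204.03826 [BlasiakCohnGrochowPrattUmans2023], §5 p. 12):

> "It follows from [Sawin 2018] that triple product property constructions inside `SL(2,q)^m`
> cannot give `ω = 2` for fixed `q` and growing `m`, and Theorem 3.2 shows that `SL(n,q)^m` cannot
> give `ω = 2` for fixed `m` and growing `q`. The proofs of these two facts are quite different: one
> uses the polynomial method, and the other is Fourier analytic. Is there a common generalization of
> these two facts that would rule out obtaining `ω = 2` with `m` and `q` both growing?
>
> Together with the fact that abelian groups cannot yield exponent less than 3, Theorem 3.2 implies
> that the alternating groups are the only simple groups left that could yield `ω = 2` via a triple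
> product property construction. The representation-theoretic argument fails in this case, since
> `A_n` has an irreducible representation of dimension `n − 1` but `|A_n| = n!/2`. Can an alternate
> argument rule out these groups?"

## Content (all proved; no definition, no named fact)

* §1 **`SL(n,q)^m`, `m` (and `n ≥ 2`) fixed, `q` growing** — Thm. 3.2 / Cor. 3.3 in the power:
  `n(SL_n(q)^m) = n(SL_n(q)) ≥ q^{n−1}/4` (`secondCharDegree_SL_pow_ge`, from the tree's
  `secondCharDegree_pow` and Landazuri–Seitz `secondCharDegree_SL_ge`), hence for every sequence of
  finite fields `Fᵢ` the sequence `SL_n(Fᵢ)^m` does NOT meet the packing bound of Def. 2.3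
  (`not_meetsPackingBound_SL_pow`, via the tree's printed Cor. 3.3 `BCGPU2023_cor33_seq` with
  `δ = (n−1)/(m n²)`), and — the catalogue's effective reading of "cannot give `ω = 2`" — there is ONE
  `ε = ε(n,m) > 0` such that in every `SL_n(F)^m`, `F` any finite field, the Cohn–Umans inequality of
  Thm. 2.2 holds on `[2, 2 + ε]` for every TPP triple (`exists_eps_noCertificate_SL_pow`; large `|G|`
  by Cor. 3.3 `exists_eps_noCertificate_of_secondCharDegree_ge`, the finitely many small fields by the
  tree's Cor. 3.5 lemmas `exists_eps_noCertificate_of_card_le` / `noCertificate_of_card_le_eleven`).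
* §2 **`SL(n,q)^m`, `q` (and `n ≥ 2`) fixed, `m` growing** — "[Sawin 2018]": the instance
  `G = SL_n(𝔽_q)` of the tree's PROVED `Sawin2018_thm15_stpp` (Sawin 2018 Thm. 1.5 / Lemma 1.3 with
  BCCGU 2017 Thm. 2.8–2.9): one `ε = ε(n,q) > 0` such that every STPP construction, in particular every
  TPP triple, in every power `SL_n(𝔽_q)^m` satisfies Thm. 2.2's inequality (CKSU (2.2)) at `2 + ε`
  (`exists_eps_noCertificate_SL_pow_fixed_field`, `…_tpp`).
* §3 **The alternating groups escape Cor. 3.3**: `2 ≤ n(A_n) ≤ n − 1` for `n ≥ 4`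
  (`secondCharDegree_alternatingGroup_le`; the irreducible character `|fix| − 1` of the 2-transitive
  group `A_n`, James–Liebeck 29.11 (1), the tree's `isIrrChar_alternatingGroup_natCard_fixedBy_sub_one`),
  `2|A_n| = n!` (Mathlib), and therefore for EVERY `c, δ > 0`, eventually `n(A_n) < c|A_n|^δ`
  (`secondCharDegree_alternatingGroup_lt_rpow`; `n! ≥ (n/e)^n` from Mathlib's
  `Real.pow_div_factorial_le_exp`): the hypothesis "`n(Gᵢ) ≥ Ω(|Gᵢ|^δ)`" of Cor. 3.3
  (`BCGPU2023_cor33_seq`) fails for the sequence of alternating groups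
  (`alternatingGroup_not_cor33_hypothesis`), which is the printed "The representation-theoretic
  argument fails in this case".

WHAT THIS IS NOT: no statement about `ω`; nothing is claimed for `SL(n,q)^m` with `q` and `m` both
growing (open, loc. cit.), nor any NEGATIVE result for the alternating groups (open, loc. cit.: whether
`A_n` can host TPP constructions meeting the packing bound is not decided here or in print); the CFSG
sentence "the alternating groups are the only simple groups left" is not formalised.
-/

noncomputable section

open scoped BigOperators MatrixGroups
open Filter Matrix

namespace Literature.Barriers.MatrixMultiplication

open Literature.RepresentationTheory.FiniteGroups Literature.Combinatorics.Additive

/-! ## §1 `SL(n,q)^m` with `m` fixed and `q` growing (Thm. 3.2 / Cor. 3.3 in the power) -/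

section PowersFixedExponent

variable {F : Type} [Field F] [Fintype F] [DecidableEq F] {m : ℕ}

/-- `SL_{m+1}(F)` is non-abelian for `m ≥ 1` (its `n(G)` is positive by Landazuri–Seitz in the tree).
[folklore] -/
private theorem exists_not_commute_SL' (hm : 1 ≤ m) :
    ∃ a b : SpecialLinearGroup (Fin (m + 1)) F, a * b ≠ b * a := by
  refine exists_not_commute_of_secondCharDegree_ne_zero fun h0 => ?_
  have h := secondCharDegree_SL_ge (F := F) hm
  rw [h0, Nat.cast_zero] at h
  have hq : (0 : ℝ) < (Fintype.card F : ℝ) ^ m / 4 := by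
    have : (0 : ℝ) < Fintype.card F := by exact_mod_cast Fintype.card_pos
    positivity
  linarith

/-- **`n(SL_{m+1}(q)^k) ≥ q^m/4`** (`m, k ≥ 1`): "the second-smallest dimension of an irreducible
representation of a direct product equals the second-smallest dimension among the irreducible
representations of the factors" (tree: `secondCharDegree_pow`) and Landazuri–Seitz for `SL`
(tree: `secondCharDegree_SL_ge`).
[cite: BlasiakCohnGrochowPrattUmans2023, §1.1 (p. 4) and §5 (p. 12)] [cite: LandazuriSeitz1974, Lemma 3.1] -/
theorem secondCharDegree_SL_pow_ge (hm : 1 ≤ m) {k : ℕ} (hk : 1 ≤ k) :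
    (Fintype.card F : ℝ) ^ m / 4 ≤
      secondCharDegree (Fin k → SpecialLinearGroup (Fin (m + 1)) F) := by
  rw [secondCharDegree_pow (exists_not_commute_SL' hm) hk]
  exact secondCharDegree_SL_ge hm

/-- `|SL_{m+1}(F)| ≤ q^{(m+1)²}`. [folklore] -/
private theorem card_SL_le_pow (m : ℕ) :
    Fintype.card (SpecialLinearGroup (Fin (m + 1)) F) ≤ Fintype.card F ^ ((m + 1) * (m + 1)) := by
  calc Fintype.card (SpecialLinearGroup (Fin (m + 1)) F)
      ≤ Fintype.card (Matrix (Fin (m + 1)) (Fin (m + 1)) F) :=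
        Fintype.card_le_of_injective _ Subtype.val_injective
    _ = Fintype.card F ^ ((m + 1) * (m + 1)) := by
        change Fintype.card (Fin (m + 1) → Fin (m + 1) → F) = _
        rw [Fintype.card_fun, Fintype.card_fun, Fintype.card_fin, ← pow_mul, mul_comm]

/-- `|SL_{m+1}(F)^k| ≤ q^{(m+1)² k}`. [folklore] -/
private theorem card_SL_pow_le_pow (m k : ℕ) :
    Fintype.card (Fin k → SpecialLinearGroup (Fin (m + 1)) F) ≤
      Fintype.card F ^ ((m + 1) * (m + 1) * k) := by
  rw [Fintype.card_fun, Fintype.card_fin, pow_mul]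
  exact Nat.pow_le_pow_left (card_SL_le_pow m) k

/-- The `|G|^δ` form of the input for a power: `(1/4)|SL_{m+1}(q)^k|^{m/((m+1)²k)} ≤ n(SL_{m+1}(q)^k)`.
[cite: BlasiakCohnGrochowPrattUmans2023, Cor. 3.4 (proof, bounded rank) and §5 (p. 12)] -/
theorem secondCharDegree_SL_pow_ge_rpow (hm : 1 ≤ m) {k : ℕ} (hk : 1 ≤ k) :
    (1 / 4 : ℝ) * (Fintype.card (Fin k → SpecialLinearGroup (Fin (m + 1)) F) : ℝ) ^
        ((m : ℝ) / ((m + 1) * (m + 1) * k : ℕ)) ≤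
      secondCharDegree (Fin k → SpecialLinearGroup (Fin (m + 1)) F) :=
  secondCharDegree_ge_rpow_of_card_le (Nat.mul_pos (Nat.mul_pos m.succ_pos m.succ_pos) hk)
    (secondCharDegree_SL_pow_ge hm hk) (card_SL_pow_le_pow m k)

/-- **BCGPU 2023, §5: "Theorem 3.2 shows that `SL(n,q)^m` cannot give `ω = 2` for fixed `m` and
growing `q`"** — packing form (Cor. 3.3 as printed, Def. 2.3): for `n ≥ 2`, `k ≥ 1` fixed and ANY
sequence of finite fields `Fᵢ`, the sequence of powers `SL_n(Fᵢ)^k` does not meet the packing bound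
(`n(SL_n(q)^k) ≥ ¼|SL_n(q)^k|^{(n−1)/(n²k)}` and `BCGPU2023_cor33_seq`).
[cite: BlasiakCohnGrochowPrattUmans2023, §5 (p. 12) and Cor. 3.3] -/
theorem not_meetsPackingBound_SL_pow (F : ℕ → Type) [∀ i, Field (F i)] [∀ i, Fintype (F i)]
    [∀ i, DecidableEq (F i)] {n : ℕ} (hn : 2 ≤ n) {k : ℕ} (hk : 1 ≤ k) :
    ¬ MeetsPackingBound (fun i => Fin k → SpecialLinearGroup (Fin n) (F i)) := by
  obtain ⟨m, rfl⟩ : ∃ m, n = m + 1 := ⟨n - 1, by omega⟩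
  have hm : 1 ≤ m := by omega
  exact BCGPU2023_cor33_seq _ (c := 1 / 4) (δ := (m : ℝ) / ((m + 1) * (m + 1) * k : ℕ))
    (by norm_num) (by positivity)
    (Eventually.of_forall fun i => secondCharDegree_SL_pow_ge_rpow (F := F i) hm hk)

/-- Non-abelian groups are non-trivial. [folklore] -/
private theorem nontrivial_of_exists_not_commute' {G : Type} [Group G]
    (h : ∃ a b : G, a * b ≠ b * a) : Nontrivial G := by
  obtain ⟨a, b, hab⟩ := h
  exact ⟨⟨a * b, b * a, hab⟩⟩

/-- A power `H^k` (`k ≥ 1`) of a non-abelian group is non-abelian (constant tuples). [folklore] -/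
private theorem exists_not_commute_pow' {H : Type} [Group H] (hH : ∃ a b : H, a * b ≠ b * a)
    {k : ℕ} (hk : 1 ≤ k) : ∃ a b : Fin k → H, a * b ≠ b * a := by
  obtain ⟨a, b, hab⟩ := hH
  refine ⟨fun _ => a, fun _ => b, fun h => hab ?_⟩
  have := congrFun h ⟨0, hk⟩
  simpa using this

/-- **BCGPU 2023, §5, `SL(n,q)^m` with `m` fixed — effective form, one `ε` for all `q`**: for `n ≥ 2`
and `k ≥ 1` there is `ε = ε(n,k) > 0` such that for EVERY finite field `F` and every triple
`S, T, U ⊆ SL_n(F)^k` with the triple product property, the inequality of Thm. 2.2 holds for all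
`w ∈ [2, 2 + ε]`: `(|S||T||U|)^{w/3} ≤ ∑ᵢ dᵢ^w` — Thm. 2.2 certifies no bound `ω < 2 + ε` from the
family `{SL_n(q)^k : q}` (the catalogue's reading of "cannot give `ω = 2`", as in
`BCGPU2023_cor34_typeA`). Large `|G|`: Cor. 3.3 (`exists_eps_noCertificate_of_secondCharDegree_ge`
with `c = 1/4`, `δ = (n−1)/(n²k)`); the finitely many small `q`: Cor. 3.5
(`exists_eps_noCertificate_of_card_le`, `noCertificate_of_card_le_eleven`).
[cite: BlasiakCohnGrochowPrattUmans2023, §5 (p. 12), Cor. 3.3 and Cor. 3.5] -/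
theorem exists_eps_noCertificate_SL_pow {n : ℕ} (hn : 2 ≤ n) {k : ℕ} (hk : 1 ≤ k) :
    ∃ ε : ℝ, 0 < ε ∧ ∀ (F : Type) [Field F] [Fintype F] [DecidableEq F]
      (S T U : Finset (Fin k → SpecialLinearGroup (Fin n) F)), TripleProductProperty S T U →
      ∀ w : ℝ, 2 ≤ w → w ≤ 2 + ε →
        ((S.card * T.card * U.card : ℕ) : ℝ) ^ (w / 3) ≤
          charDegreePowSum (Fin k → SpecialLinearGroup (Fin n) F) w := by
  obtain ⟨m, rfl⟩ : ∃ m, n = m + 1 := ⟨n - 1, by omega⟩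
  have hm : 1 ≤ m := by omega
  have hδ : (0 : ℝ) < (m : ℝ) / ((m + 1) * (m + 1) * k : ℕ) := by positivity
  obtain ⟨ε₂, hε₂, N₀, hN₀⟩ :=
    exists_eps_noCertificate_of_secondCharDegree_ge (c := 1 / 4) (by norm_num) hδ
  obtain ⟨ε₃, hε₃, hsmall⟩ := exists_eps_noCertificate_of_card_le N₀
  refine ⟨min (1 / 200) (min ε₂ ε₃), lt_min (by norm_num) (lt_min hε₂ hε₃), ?_⟩
  intro F _ _ _ S T U hTPP w hw2 hwε
  have hε200 : min (1 / 200 : ℝ) (min ε₂ ε₃) ≤ 1 / 200 := min_le_left _ _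
  have hεε₂ : min (1 / 200 : ℝ) (min ε₂ ε₃) ≤ ε₂ := (min_le_right _ _).trans (min_le_left _ _)
  have hεε₃ : min (1 / 200 : ℝ) (min ε₂ ε₃) ≤ ε₃ := (min_le_right _ _).trans (min_le_right _ _)
  by_cases hbig : N₀ ≤ (Fintype.card (Fin k → SpecialLinearGroup (Fin (m + 1)) F) : ℝ)
  · exact hN₀ (Fin k → SpecialLinearGroup (Fin (m + 1)) F)
      (exists_not_commute_pow' (exists_not_commute_SL' hm) hk) hbig
      (secondCharDegree_SL_pow_ge_rpow hm hk) S T U hTPP w hw2 (by linarith)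
  · push Not at hbig
    by_cases h12 : 12 ≤ Fintype.card (Fin k → SpecialLinearGroup (Fin (m + 1)) F)
    · exact hsmall (Fin k → SpecialLinearGroup (Fin (m + 1)) F) h12 hbig.le S T U hTPP w hw2
        (by linarith)
    · exact noCertificate_of_card_le_eleven (Fin k → SpecialLinearGroup (Fin (m + 1)) F)
        (by omega) S T U hTPP hw2 (by linarith)

end PowersFixedExponent

/-! ## §2 `SL(n,q)^m` with `q` fixed and `m` growing (Sawin 2018) -/

section PowersFixedField

variable (F : Type) [Field F] [Fintype F] [DecidableEq F]

/-- **BCGPU 2023, §5: "It follows from [Sawin 2018] that triple product property constructions inside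
`SL(2,q)^m` cannot give `ω = 2` for fixed `q` and growing `m`"** — the instance `G = SL_n(𝔽_q)`
(`n ≥ 2`, any fixed finite field) of the tree's PROVED `Sawin2018_thm15_stpp` (Sawin 2018, Thm. 1.5 /
Lemma 1.3, with BCCGU 2017, Thm. 2.8–2.9): one `ε = ε(n,q) > 0` such that for EVERY `m` and every STPP
construction `(Aᵢ, Bᵢ, Cᵢ)_{i<N}` in `SL_n(𝔽_q)^m` (CKSU Def. 5.1, the tree's `SimultaneousTPP`) the
CKSU inequality (2.2) holds at `w = 2 + ε`: `∑ᵢ (|Aᵢ||Bᵢ||Cᵢ|)^{(2+ε)/3} ≤ ∑ⱼ dⱼ(SL_n(𝔽_q)^m)^{2+ε}`.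
[cite: BlasiakCohnGrochowPrattUmans2023, §5 (p. 12)] [cite: Sawin2018, Thm. 1.5] -/
theorem exists_eps_noCertificate_SL_pow_fixed_field {n : ℕ} (hn : 2 ≤ n) :
    ∃ ε : ℝ, 0 < ε ∧ ∀ (m N : ℕ) (A B C : Fin N → Finset (Fin m → SpecialLinearGroup (Fin n) F)),
      SimultaneousTPP A B C →
      ∑ i, (((A i).card * (B i).card * (C i).card : ℕ) : ℝ) ^ ((2 + ε) / 3) ≤
        charDegreePowSum (Fin m → SpecialLinearGroup (Fin n) F) (2 + ε) := by
  obtain ⟨k, rfl⟩ : ∃ k, n = k + 1 := ⟨n - 1, by omega⟩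
  have hk : 1 ≤ k := by omega
  haveI : Nontrivial (SpecialLinearGroup (Fin (k + 1)) F) :=
    nontrivial_of_exists_not_commute' (exists_not_commute_SL' hk)
  exact Sawin2018_thm15_stpp (SpecialLinearGroup (Fin (k + 1)) F)

/-- The same for a single triple `S, T, U ⊆ SL_n(𝔽_q)^m` with the triple product property (a
one-member STPP construction): `(|S||T||U|)^{(2+ε)/3} ≤ ∑ⱼ dⱼ^{2+ε}` with the `ε = ε(n,q)` above,
for every `m`. [cite: BlasiakCohnGrochowPrattUmans2023, §5 (p. 12)] [cite: Sawin2018, Thm. 1.5] -/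
theorem exists_eps_noCertificate_SL_pow_fixed_field_tpp {n : ℕ} (hn : 2 ≤ n) :
    ∃ ε : ℝ, 0 < ε ∧ ∀ (m : ℕ) (S T U : Finset (Fin m → SpecialLinearGroup (Fin n) F)),
      TripleProductProperty S T U →
      (((S.card * T.card * U.card : ℕ) : ℝ)) ^ ((2 + ε) / 3) ≤
        charDegreePowSum (Fin m → SpecialLinearGroup (Fin n) F) (2 + ε) := by
  obtain ⟨ε, hε, h⟩ := exists_eps_noCertificate_SL_pow_fixed_field F hn
  refine ⟨ε, hε, fun m S T U hTPP => ?_⟩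
  have hS : SimultaneousTPP (fun _ : Fin 1 => S) (fun _ => T) (fun _ => U) :=
    ⟨fun _ => hTPP, fun i j l _ _ _ _ _ _ _ _ _ _ _ _ _ =>
      ⟨Subsingleton.elim _ _, Subsingleton.elim _ _⟩⟩
  have h1 := h m 1 (fun _ => S) (fun _ => T) (fun _ => U) hS
  simpa using h1

end PowersFixedField

/-! ## §3 The alternating groups escape Cor. 3.3 -/

section Alternating

open MulAction

/-- **"`A_n` has an irreducible representation of dimension `n − 1`"** (BCGPU 2023, §5), whence
`2 ≤ n(A_n) ≤ n − 1` for `n ≥ 4`: the character `σ ↦ |fix(σ)| − 1` of the 2-transitive group `A_n`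
is irreducible (James–Liebeck 29.11 (1); tree `isIrrChar_alternatingGroup_natCard_fixedBy_sub_one`).
(For `n ≥ 5`, in fact `n(A_n) = n − 1` except `n(A_5) = 3`; only the printed upper bound is claimed.)
[cite: BlasiakCohnGrochowPrattUmans2023, §5 (p. 12)] [cite: JamesLiebeck2001, Ex. 29.11 (1)] -/
theorem secondCharDegree_alternatingGroup_le {n : ℕ} (hn : 4 ≤ n) :
    2 ≤ secondCharDegree (alternatingGroup (Fin n)) ∧
      secondCharDegree (alternatingGroup (Fin n)) ≤ n - 1 := by
  have hχ := isIrrChar_alternatingGroup_natCard_fixedBy_sub_one (Ω := Fin n)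
    (by rw [Nat.card_eq_fintype_card, Fintype.card_fin]; exact hn)
  obtain ⟨d, hd, hχd⟩ := hχ.exists_apply_one
  have h1 : Nat.card (fixedBy (Fin n) (1 : alternatingGroup (Fin n))) = n := by
    rw [natCard_fixedBy_one, Nat.card_eq_fintype_card, Fintype.card_fin]
  have hdn : d = n - 1 := by
    have h' : ((n : ℂ)) - 1 = (d : ℂ) := by simpa [h1] using hχd
    have h'' : ((n - 1 : ℕ) : ℂ) = (d : ℂ) := by
      rw [Nat.cast_sub (by omega : 1 ≤ n), Nat.cast_one]; exact h'
    exact (Nat.cast_injective h'').symm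
  subst hdn
  exact secondCharDegree_le hd (by omega)

/-- **"but `|A_n| = n!/2`"**: `2|A_n| = n!` (Mathlib's `two_mul_card_alternatingGroup`).
[cite: BlasiakCohnGrochowPrattUmans2023, §5 (p. 12)] -/
theorem two_mul_card_alternatingGroup_fin {n : ℕ} (hn : 2 ≤ n) :
    2 * Fintype.card (alternatingGroup (Fin n)) = n.factorial := by
  haveI : Nontrivial (Fin n) := Fin.nontrivial_iff_two_le.mpr hn
  rw [two_mul_card_alternatingGroup, Fintype.card_perm, Fintype.card_fin]

/-- `n! ≥ n^k` eventually (for `n ≥ max 9 (2k)`), from `n! ≥ (n/e)^n`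
(Mathlib's `Real.pow_div_factorial_le_exp`) and `e < 3`. [folklore] -/
private theorem pow_le_factorial_of_le {k n : ℕ} (h9 : 9 ≤ n) (hk : 2 * k ≤ n) :
    (n : ℝ) ^ k ≤ (n.factorial : ℝ) := by
  have hn0 : (0 : ℝ) < n := by exact_mod_cast (show 0 < n by omega)
  have hfac : (0 : ℝ) < n.factorial := by exact_mod_cast Nat.factorial_pos n
  -- `n^n / n! ≤ e^n`
  have h1 : (n : ℝ) ^ n / n.factorial ≤ Real.exp n :=
    Real.pow_div_factorial_le_exp (n : ℝ) hn0.le n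
  have h2 : (n : ℝ) ^ n ≤ Real.exp n * n.factorial := by
    rwa [div_le_iff₀ hfac] at h1
  -- `e^n ≤ 3^n ≤ 9^(n-k) ≤ n^(n-k)`
  have he : Real.exp (n : ℝ) ≤ (n : ℝ) ^ (n - k) := by
    have h3 : Real.exp (n : ℝ) ≤ (3 : ℝ) ^ n := by
      rw [← mul_one (n : ℝ), Real.exp_nat_mul]
      exact pow_le_pow_left₀ (Real.exp_pos 1).le Real.exp_one_lt_three.le n
    have h4 : (3 : ℝ) ^ n ≤ (9 : ℝ) ^ (n - k) := by
      calc (3 : ℝ) ^ n ≤ (3 : ℝ) ^ (2 * (n - k)) := pow_le_pow_right₀ (by norm_num) (by omega)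
        _ = (9 : ℝ) ^ (n - k) := by rw [pow_mul]; norm_num
    have h5 : (9 : ℝ) ^ (n - k) ≤ (n : ℝ) ^ (n - k) :=
      pow_le_pow_left₀ (by norm_num) (by exact_mod_cast h9) _
    exact h3.trans (h4.trans h5)
  -- combine: `n^k · n^(n-k) = n^n ≤ e^n n! ≤ n^(n-k) n!`
  have hsplit : (n : ℝ) ^ n = (n : ℝ) ^ k * (n : ℝ) ^ (n - k) := by
    rw [← pow_add]; congr 1; omega
  have hpos : (0 : ℝ) < (n : ℝ) ^ (n - k) := pow_pos hn0 _
  have h6 : (n : ℝ) ^ k * (n : ℝ) ^ (n - k) ≤ (n.factorial : ℝ) * (n : ℝ) ^ (n - k) := by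
    calc (n : ℝ) ^ k * (n : ℝ) ^ (n - k) = (n : ℝ) ^ n := hsplit.symm
      _ ≤ Real.exp n * n.factorial := h2
      _ ≤ (n : ℝ) ^ (n - k) * n.factorial := by gcongr
      _ = (n.factorial : ℝ) * (n : ℝ) ^ (n - k) := mul_comm _ _
  exact le_of_mul_le_mul_right h6 hpos

/-- **BCGPU 2023, §5: "The representation-theoretic argument fails in this case, since `A_n` has an
irreducible representation of dimension `n − 1` but `|A_n| = n!/2`"** — for EVERY `c > 0` and `δ > 0`,
eventually in `n`, `n(A_n) < c·|A_n|^δ`: no pair `(c, δ)` makes the alternating groups satisfy the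
hypothesis `n(Gᵢ) ≥ c|Gᵢ|^δ` of Cor. 3.3 (`BCGPU2023_cor33_seq`). Proof: `n(A_n) ≤ n − 1` and
`|A_n| = n!/2 ≥ n^k/2` for any fixed `k` and large `n`; take `kδ ≥ 2`.
[cite: BlasiakCohnGrochowPrattUmans2023, §5 (p. 12)] -/
theorem secondCharDegree_alternatingGroup_lt_rpow {c δ : ℝ} (hc : 0 < c) (hδ : 0 < δ) :
    ∀ᶠ n : ℕ in atTop, (secondCharDegree (alternatingGroup (Fin n)) : ℝ) <
      c * (Fintype.card (alternatingGroup (Fin n)) : ℝ) ^ δ := by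
  -- `k` with `k δ ≥ 2`
  obtain ⟨k, hk⟩ : ∃ k : ℕ, 2 / δ ≤ k := exists_nat_ge (2 / δ)
  have hkδ : 2 ≤ (k : ℝ) * δ := by rwa [div_le_iff₀ hδ] at hk
  -- threshold in `n`: `n ≥ 9`, `n ≥ 2k`, and `2^δ / c < n` (so that `n ≤ c 2^{-δ} n²`)
  obtain ⟨B, hB⟩ : ∃ B : ℕ, (2 : ℝ) ^ δ / c ≤ B := exists_nat_ge _
  filter_upwards [eventually_ge_atTop (max (max 9 (2 * k)) (B + 1))] with n hn
  have h9 : 9 ≤ n := le_trans (le_trans (le_max_left _ _) (le_max_left _ _)) hn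
  have h2k : 2 * k ≤ n := le_trans (le_trans (le_max_right _ _) (le_max_left _ _)) hn
  have hBn : B + 1 ≤ n := le_trans (le_max_right _ _) hn
  have hn1 : (1 : ℝ) ≤ n := by exact_mod_cast (show 1 ≤ n by omega)
  have hn0 : (0 : ℝ) < n := by linarith
  -- `n(A_n) ≤ n - 1 < n`
  have hdeg : (secondCharDegree (alternatingGroup (Fin n)) : ℝ) < n := by
    have h := (secondCharDegree_alternatingGroup_le (n := n) (by omega)).2
    have h' : (secondCharDegree (alternatingGroup (Fin n)) : ℝ) ≤ ((n - 1 : ℕ) : ℝ) := by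
      exact_mod_cast h
    rw [Nat.cast_sub (by omega : 1 ≤ n), Nat.cast_one] at h'
    linarith
  -- `|A_n| = n!/2 ≥ n^k / 2`
  have hcard : (n : ℝ) ^ k / 2 ≤ (Fintype.card (alternatingGroup (Fin n)) : ℝ) := by
    have h2 := two_mul_card_alternatingGroup_fin (n := n) (by omega)
    have h2' : (2 : ℝ) * (Fintype.card (alternatingGroup (Fin n)) : ℝ) = (n.factorial : ℝ) := by
      exact_mod_cast h2
    have hf := pow_le_factorial_of_le h9 h2k
    rw [div_le_iff₀ (by norm_num : (0 : ℝ) < 2), mul_comm, h2']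
    exact hf
  -- `c (n^k/2)^δ = c 2^{-δ} n^{kδ} ≥ c 2^{-δ} n² ≥ n`
  have hA0 : (0 : ℝ) ≤ (n : ℝ) ^ k / 2 := by positivity
  have hpow : c * ((n : ℝ) ^ k / 2) ^ δ ≤ c * (Fintype.card (alternatingGroup (Fin n)) : ℝ) ^ δ :=
    mul_le_mul_of_nonneg_left (Real.rpow_le_rpow hA0 hcard hδ.le) hc.le
  have hkey : (n : ℝ) ≤ c * ((n : ℝ) ^ k / 2) ^ δ := by
    have hsplit : ((n : ℝ) ^ k / 2) ^ δ = (n : ℝ) ^ ((k : ℝ) * δ) / (2 : ℝ) ^ δ := by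
      rw [Real.div_rpow (by positivity) (by norm_num), ← Real.rpow_natCast,
        ← Real.rpow_mul hn0.le]
    have hnkδ : (n : ℝ) ^ (2 : ℝ) ≤ (n : ℝ) ^ ((k : ℝ) * δ) :=
      Real.rpow_le_rpow_of_exponent_le hn1 hkδ
    have hn2 : (n : ℝ) ^ (2 : ℝ) = (n : ℝ) * n := by
      rw [show (2 : ℝ) = (2 : ℕ) by norm_num, Real.rpow_natCast, pow_two]
    have h2δ : (0 : ℝ) < (2 : ℝ) ^ δ := Real.rpow_pos_of_pos (by norm_num) δ
    -- from `2^δ / c ≤ B < n`: `2^δ ≤ c n`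
    have hcn : (2 : ℝ) ^ δ ≤ c * n := by
      have hB' : (B : ℝ) + 1 ≤ n := by exact_mod_cast hBn
      have : (2 : ℝ) ^ δ / c ≤ n := by linarith
      rwa [div_le_iff₀ hc, mul_comm] at this
    rw [hsplit, mul_div_assoc']
    rw [le_div_iff₀ h2δ]
    calc (n : ℝ) * (2 : ℝ) ^ δ ≤ (n : ℝ) * (c * n) := by gcongr
      _ = c * (n : ℝ) ^ (2 : ℝ) := by rw [hn2]; ring
      _ ≤ c * (n : ℝ) ^ ((k : ℝ) * δ) := by gcongr
  linarith

/-- Hence the hypothesis of Cor. 3.3 in its printed sequence form (`BCGPU2023_cor33_seq`: eventually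
`c|Gᵢ|^δ ≤ n(Gᵢ)`) FAILS for the sequence of alternating groups `(A_n)_n`, whatever `c, δ > 0`.
[cite: BlasiakCohnGrochowPrattUmans2023, §5 (p. 12)] -/
theorem alternatingGroup_not_cor33_hypothesis {c δ : ℝ} (hc : 0 < c) (hδ : 0 < δ) :
    ¬ ∀ᶠ n : ℕ in atTop, c * (Fintype.card (alternatingGroup (Fin n)) : ℝ) ^ δ ≤
      secondCharDegree (alternatingGroup (Fin n)) := by
  intro h
  obtain ⟨n, hn1, hn2⟩ := (h.and (secondCharDegree_alternatingGroup_lt_rpow hc hδ)).exists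
  linarith

end Alternating

end Literature.Barriers.MatrixMultiplication

end
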